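import Literature.Computability.AlgebraicComplexity.BI17TensorGenericWitnessCertificates
import HarnessLib

/-!
# An explicit stable tensor in `⊗³ℂ^m` for every `m ≥ 3` (BI 2017 Prop. 4.10, programme #5 input)

Programme-#5 brick T4b, wrapper (val-lit cell): t02 g6's witness
`v_m = genericWitness n` (`m = n + 3`; `BI17TensorGenericWitness.lean`) is POLYSTABLE
(`isPolystableTensor_genericWitness`, free support with uniform marginals, BI Prop. 4.8) and has
ZERO TRACELESS INFINITESIMAL STABILIZER for every `n`: `n ≥ 2` by the hand elimination
`hasTrivialSL3LieStabilizer_genericWitness_of_two_le` (t02 g6), `n = 0, 1` by the kernel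
certificates `hasTrivialSL3LieStabilizer_genericWitness_zero/_one`
(`BI17TensorGenericWitnessCertificates.lean`, t13 g6). Packaged as `exists_stable_genericWitness` —
verbatim the hypothesis of `BI2017_prop_4_10_of_exists_stable_add_three`
(`TensorGenericPolystability.lean`, t09 g6), whose one-line consequences `BI2017_prop_4_10_holds`,
`Popov1970_genericClosedOrbit_tensor_holds`, `BI2017_cor_5_12_holds` are filed by the T5 seat.

Theorem-only file (no definitions, no named facts). Honest framing: typed ≠ endorsed; nothing here
bears on VP versus VNP. [cite: BurgisserIkenmeyer2017, Prop. 4.10 (proof: "stab'(w) is finite for almost all w")]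

## References

* P. Bürgisser, C. Ikenmeyer, *Fundamental invariants of orbit closures*, J. Algebra 477 (2017),
  §4.1–4.2, Prop. 4.8, Prop. 4.10. [BurgisserIkenmeyer2017]
-/

set_option Elab.async false

noncomputable section

namespace Literature.Computability.AlgebraicComplexity

/-- **`v_m = genericWitness n` has zero traceless infinitesimal stabilizer for every `m = n + 3 ≥ 3`**
(`n = 0, 1`: kernel certificates; `n ≥ 2`: hand elimination).
[cite: BurgisserIkenmeyer2017, §4.1 eq. (4.1) and Prop. 4.10 (proof)] -/
theorem hasTrivialSL3LieStabilizer_genericWitness (n : ℕ) :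
    HasTrivialSL3LieStabilizer (genericWitness n) := by
  rcases n with _ | _ | k
  · exact hasTrivialSL3LieStabilizer_genericWitness_zero
  · exact hasTrivialSL3LieStabilizer_genericWitness_one
  · exact hasTrivialSL3LieStabilizer_genericWitness_of_two_le (k + 2) (by omega)

/-- Hence the `SL³`-stabilizer of `v_m` is finite: **`v_m` is a STABLE tensor** (closed orbit by
`isPolystableTensor_genericWitness`, finite stabilizer here).
[cite: BurgisserIkenmeyer2017, Prop. 4.10 (proof: "stab'(w) is finite")] -/
theorem finite_slStabilizer_genericWitness (n : ℕ) :
    {g : Matrix.SpecialLinearGroup (Fin (n + 3)) ℂ × Matrix.SpecialLinearGroup (Fin (n + 3)) ℂ ×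
        Matrix.SpecialLinearGroup (Fin (n + 3)) ℂ |
      actTensor (g.1 : Matrix (Fin (n + 3)) (Fin (n + 3)) ℂ) (g.2.1 : Matrix (Fin (n + 3)) (Fin (n + 3)) ℂ)
        (g.2.2 : Matrix (Fin (n + 3)) (Fin (n + 3)) ℂ) (genericWitness n) = genericWitness n}.Finite :=
  finite_slStabilizer_of_hasTrivialSL3LieStabilizer _ (hasTrivialSL3LieStabilizer_genericWitness n)

/-- **For every `m = n + 3 ≥ 3` there is an explicit polystable tensor in `⊗³ℂ^m` with zero
traceless infinitesimal stabilizer** — verbatim the hypothesis of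
`BI2017_prop_4_10_of_exists_stable_add_three`. [cite: BurgisserIkenmeyer2017, Prop. 4.10 (proof)] -/
theorem exists_stable_genericWitness (n : ℕ) :
    ∃ w₀ : Fin (n + 3) → Fin (n + 3) → Fin (n + 3) → ℂ,
      IsPolystableTensor w₀ ∧ HasTrivialSL3LieStabilizer w₀ :=
  ⟨genericWitness n, isPolystableTensor_genericWitness n, hasTrivialSL3LieStabilizer_genericWitness n⟩

/-- The same for every `m ≥ 3`, in the shape of `BI2017_prop_4_10_of_exists_stable`.
[cite: BurgisserIkenmeyer2017, Prop. 4.10 (proof)] -/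
theorem exists_stable_tensor_of_three_le (m : ℕ) (hm : 3 ≤ m) :
    ∃ w₀ : Fin m → Fin m → Fin m → ℂ, IsPolystableTensor w₀ ∧ HasTrivialSL3LieStabilizer w₀ := by
  obtain ⟨n, rfl⟩ : ∃ n, m = n + 3 := ⟨m - 3, by omega⟩
  exact exists_stable_genericWitness n

end Literature.Computability.AlgebraicComplexity

end
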